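import Summits.KontsevichZagierPeriods.KontsevichZagierPeriods.Theses.HurwitzMicroSectors
import Summits.KontsevichZagierPeriods.KontsevichZagierPeriods.Theorems.HurwitzMicroSectorsNormalFormPrinciplePiBoxTransfer
import Summits.KontsevichZagierPeriods.KontsevichZagierPeriods.Theorems.HurwitzMicroSectorsNormalFormPrincipleVariants2200

/-! TTRL-lite variant V2241 of stmt-KontsevichZagierPeriods-3869

Variant V2241 = `stub_boxRigidity` (BoxRigidity: two box-rational representations with equal values are
KZ-equivalent) under the programmatic move `bound_nat:m'≤3` (the right dimension bounded, the left
dimension `m` free). Verdict of the attempt seat: **open, and provably as hard as the parent** — this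
file is the hardness certificate, not a proof of the variant. The bound `m' ≤ 3` admits `m' = 0`, and
the one-sided specialisation with the right dimension frozen to any `m₀` is already equivalent to the
whole leaf (`boxRigidityRight_iff`, file `…Variants2200`; the bounded form for every `k` is
`boxRigidityRightLe_iff k`, file `…Variants2256`): the zero representation on the `m₀`-box is
box-rational of value `0`, so every box-rational representation of value `0` (any dimension) becomes
a relation (BoxVanishing), and BoxVanishing is BoxRigidity (`boxRigidity_of_boxVanishing`). Hence
`KontsevichZagierPeriods → V2241 → KZ.PiLocalKernel` (`stub_boxRigidity_var2241_of_statement`,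
`piLocalKernel_of_stub_boxRigidity_var2241`): the variant sits between the Summit and Ayoub's
localised kernel conjecture (`@[conjecture]`, open in the tree), so it is neither provable nor
refutable from the tree, and `Summit ⟺ V2241 ∧ PiCancellation`. The programmatic moves
`bound_nat:m'≤k` / `bound_nat:m≤k` of this stub never produce an easier statement (any `k`).
Source: M. Kontsevich, D. Zagier, *Periods* (2001), §1.2 Conjecture 1; J. Ayoub, EMS Newsl. 91 (2014),
Conj. 7. Pure proof file, no definitions. -/

-- `Summit.<Summit>.<Problem>` is the tree's mandated summit-side namespace (CONVENTIONS §2); for this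
-- single-conjunct summit the two coincide, so the duplicate is deliberate.
set_option linter.dupNamespace false

noncomputable section

namespace Summit.KontsevichZagierPeriods.KontsevichZagierPeriods.Theorems

open MeasureTheory Set
open Literature.NumberTheory.Transcendental Literature.NumberTheory.Transcendental.KZ
open Summit.KontsevichZagierPeriods.KontsevichZagierPeriods.Theses.HurwitzMicroSectors
open Summit.KontsevichZagierPeriods.HurwitzMicroSectors.NormalFormPrinciple.PiBox

/-! ## The variant V2241 itself: between the Summit and `KZ.PiLocalKernel` -/

/-- **V2241 ⟺ the parent leaf `BoxRigidity`** (the instance `m' = 0` of the bound and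
`boxRigidityRight_iff 0`, file `…Variants2200`; equally the instance `k = 3` of
`boxRigidityRightLe_iff`, file `…Variants2256`). [cite: KontsevichZagier2001, §1.2 Conjecture 1] -/
theorem stub_boxRigidity_var2241_iff_parent :
    (∀ (m m' : ℕ) (N : IntegralRep m) (N' : IntegralRep m'), m' ≤ 3 → N.domain = {x | ∀ i, x i ∈ Set.Ioo (0:ℝ) 1} → N.IsRational → N'.domain = {x | ∀ i, x i ∈ Set.Ioo (0:ℝ) 1} → N'.IsRational → N.value = N'.value → Equivalent N N') ↔
    (∀ (m m' : ℕ) (N : IntegralRep m) (N' : IntegralRep m'), N.domain = {x | ∀ i, x i ∈ Set.Ioo (0:ℝ) 1} → N.IsRational → N'.domain = {x | ∀ i, x i ∈ Set.Ioo (0:ℝ) 1} → N'.IsRational → N.value = N'.value → Equivalent N N') :=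
  ⟨fun h => (boxRigidityRight_iff 0).1 fun m N N' => h m 0 N N' (Nat.zero_le 3),
    fun h m m' N N' _ => h m m' N N'⟩

/-- **V2241 ⇒ `KZ.PiLocalKernel`** (Ayoub's localised kernel conjecture for this calculus — open): a
proof of the variant would settle an open conjecture of the tree. [cite: Ayoub2014, Def. 6 and Conj. 7] -/
theorem piLocalKernel_of_stub_boxRigidity_var2241
    (h : ∀ (m m' : ℕ) (N : IntegralRep m) (N' : IntegralRep m'), m' ≤ 3 → N.domain = {x | ∀ i, x i ∈ Set.Ioo (0:ℝ) 1} → N.IsRational → N'.domain = {x | ∀ i, x i ∈ Set.Ioo (0:ℝ) 1} → N'.IsRational → N.value = N'.value → Equivalent N N') :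
    PiLocalKernel :=
  piLocalKernel_of_boxRigidity (stub_boxRigidity_var2241_iff_parent.1 h)

/-- **`KontsevichZagierPeriods ⇒ V2241`**: the variant is a special case of Conjecture 1 for the
tree's calculus — so a refutation of the variant would refute the Summit.
[cite: KontsevichZagier2001, §1.2 Conjecture 1] -/
theorem stub_boxRigidity_var2241_of_statement (h : _root_.KontsevichZagierPeriods) :
    ∀ (m m' : ℕ) (N : IntegralRep m) (N' : IntegralRep m'), m' ≤ 3 → N.domain = {x | ∀ i, x i ∈ Set.Ioo (0:ℝ) 1} → N.IsRational → N'.domain = {x | ∀ i, x i ∈ Set.Ioo (0:ℝ) 1} → N'.IsRational → N.value = N'.value → Equivalent N N' :=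
  fun m m' N N' _ => (leaves_of_statement h).1 m m' N N'

/-- **Summit ⟺ V2241 ∧ PiCancellation** (from `statement_iff_leaves`): with `π`-cancellation the variant
is exactly what the Summit needs, no more and no less. [cite: KontsevichZagier2001, §1.2 Conjecture 1] -/
theorem statement_iff_stub_boxRigidity_var2241_and_piCancellation :
    _root_.KontsevichZagierPeriods ↔
    ((∀ (m m' : ℕ) (N : IntegralRep m) (N' : IntegralRep m'), m' ≤ 3 → N.domain = {x | ∀ i, x i ∈ Set.Ioo (0:ℝ) 1} → N.IsRational → N'.domain = {x | ∀ i, x i ∈ Set.Ioo (0:ℝ) 1} → N'.IsRational → N.value = N'.value → Equivalent N N') ∧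
      PiCancellation) := by
  rw [statement_iff_leaves, stub_boxRigidity_var2241_iff_parent]

end Summit.KontsevichZagierPeriods.KontsevichZagierPeriods.Theorems
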